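import Summits.BirchSwinnertonDyer.BirchSwinnertonDyer.Theorems.AdditiveBranchIMCGordTwoRankOneTameRoadRowClosed
import Summits.BirchSwinnertonDyer.BirchSwinnertonDyer.Theorems.AdditiveBranchIMCGordTwoRankZeroOffCaseOneThreeFieldRowClosedBFH
import HarnessLib

/-!
# Line `wan_tame_bdp_road` (crux `GordTwoRankOne`, stmt-BirchSwinnertonDyer-19358) — THE TAME SUB-ROW IN ANALYTIC RANK ONE FROM TEN
# PRINTED THEOREMS: Friedberg–Hoffstein's ramified F5 is now a theorem from Hoffstein–Luo 1997 and modularity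

Sequel of `AdditiveBranchIMCGordTwoRankOneTameRoadRowClosed.lean` (p728593, LEAD g8; `…_elevenFacts`) for the pen's line on crux 19358. Of the
eleven printed hypotheses of skeleton v18's `PrintedFactsTame` (Wuthrich/Kato half, Delbourgo Prop. 4, GZK, modular parametrisation, F5, Hoffstein–Luo
1997, Cai–Shu–Tian 1.1 ring class, Hsieh B, Liu–Zhang–Zhang, Castella–Liu–Wan 8.2.1 and §6.1), Friedberg–Hoffstein's central-value twist with ONE
RAMIFIED prime (F5, `friedbergHoffstein_exists_twist_ne_zero_ramifiedAt_splitAt`, consumed by the field supply `WanTameBdpRoadSupply.exists_fieldOne_gordTwo_rankOne`)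
IS NOW A THEOREM on the tame row, from Hoffstein–Luo 1997 and the modular parametrisation — both already on the list — through LEAD g11's engine
for the root number of a quadratic twist RAMIFIED at the non-split multiplicative Wan prime (`TwistRootNumberOdd.rootNumber_quadraticTwist_mul_eq_of_nonsplit_odd`,
every odd `q`; `TwistRootNumberOdd.exists_ramifiedAt_splitAt_twist_ne_zero_of_hoffsteinLuo_odd`; the twist-type hypotheses are discharged on the tame row of
cell (G-ord, `e = 2`) by `ThreeFieldRowClosedBFH.three_lt_ringChar_of_semistable_outside` / `…twistType_of_cellGordTwo_of_semistable_outside`).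

* `exists_fieldOne_gordTwo_rankOne_of_hoffsteinLuo` — the field supply of the rank-one tame road without F5;
* `missingLowerBoundAt_rankOne_of_tameRoadRow_tenFacts` — for `W.analyticRank = 1`, `N10.CellGordTwo W p`, `TameRoadRow W p`:
  `MissingLowerBoundAt W p` GIVEN TEN printed theorems (v18's eleven minus F5; Gross–Zagier I.(7.3), Cai–Shu–Tian for the trivial character,
  parity and the entire continuation are derived in the tree as in v18's `tameRoadRow_closed`).

THEOREMS ONLY; no definition, no named fact, no `sorry`; crux 19358 stays OPEN; BSD is proved for no curve by any of this.

References: [HoffsteinLuo1997] Theorem (§1); [FriedbergHoffstein1995] Thm. B; [Castella2018] §5; [JetchevSkinnerWan2017] §7.4.1;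
[CastellaLiuWan2022] Thm. 8.2.1 (1); [Kato2004Asterisque] Thm. 17.4; [Delbourgo1998] Prop. 4.
-/

set_option linter.dupNamespace false
set_option autoImplicit false

noncomputable section

open scoped Classical

open NumberField IsDedekindDomain IsDedekindDomain.HeightOneSpectrum Rat.HeightOneSpectrum
open WeierstrassCurve Literature.NumberTheory.EllipticCurves
  Literature.NumberTheory.EllipticCurves.ModularForms
  Literature.NumberTheory.EllipticCurves.Rank1Residual
  Literature.NumberTheory.EllipticCurves.Rank1Residual.Typed

open Summit.BirchSwinnertonDyer.Rank1Residual
open Summit.BirchSwinnertonDyer.Rank1Residual.Additive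
open Summit.BirchSwinnertonDyer.BirchSwinnertonDyer.Theorems
open Field Literature.NumberTheory.EllipticCurves.ModularForms
open ThreeFieldRoadSupply

namespace Summit.BirchSwinnertonDyer.BirchSwinnertonDyer.Theorems.TameRoadRowRankOneClosedHL

section FieldOne

variable (W : WeierstrassCurve ℚ) [W.IsElliptic] [W.IsGloballyMinimal] (p : ℕ) [hp : Fact p.Prime]

/-- **FIELD SUPPLY of the rank-one tame road WITHOUT F5** — the statement of `WanTameBdpRoadSupply.exists_fieldOne_gordTwo_rankOne` (the
tame-road field `K` with the Wan prime ramified and `L(E^{(d_K)}, 1) ≠ 0`, a globally minimal rank-zero twist `Wd` on the same cell with `ρ̄`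
onto), from Hoffstein–Luo 1997 and the Modularity Theorem (`exists_isNewformOf`) instead of Friedberg–Hoffstein's ramified F5, valid for EVERY Wan
prime (LEAD g11's `TwistRootNumberOdd.exists_ramifiedAt_splitAt_twist_ne_zero_of_hoffsteinLuo_odd`; the tame row is of quadratic-twist type).
[cite: HoffsteinLuo1997, Theorem (§1, pp. 435–436)] [cite: Castella2018, §5 (arXiv:1704.06608 p. 12)] [cite: SilvermanAEC2009, X.5 Cor. 5.4 and Thm VII.6.1] -/
theorem exists_fieldOne_gordTwo_rankOne_of_hoffsteinLuo (hnf : exists_isNewformOf)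
    (hHL : HoffsteinLuo1997_exists_twist_L_one_ne_zero)
    (hpar : ∀ X : WeierstrassCurve ℚ, even_analyticRank_iff_rootNumber_eq_one X)
    (hmod : hasEntireLFunction_rat)
    (hp5 : 5 ≤ p) (hr : W.analyticRank = 1) (hcell : N10.CellGordTwo W p) (hsurj : Surj W p)
    (hss : ∀ ℓ : ℕ, (hℓ : ℓ.Prime) → ℓ ≠ p →
      (haveI : Fact ℓ.Prime := ⟨hℓ⟩; W.HasGoodReductionAtPrime ℓ ∨ W.HasMultiplicativeReductionAtPrime ℓ))
    {q : ℕ} [Fact q.Prime] (hqp : q ≠ p) (hq2 : q ≠ 2)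
    (hqm : W.HasMultiplicativeReductionAtPrime q) (hqns : ¬ W.HasSplitMultiplicativeReductionAtPrime q) :
    ∃ (K : Type) (_ : Field K) (_ : NumberField K)
      (Wd : WeierstrassCurve ℚ) (_ : Wd.IsElliptic) (_ : Wd.IsGloballyMinimal),
      IsImaginaryQuadratic K ∧ (q : ℤ) ∣ NumberField.discr K ∧
        (∀ ℓ : ℕ, ℓ.Prime → ℓ ∣ W.conductorNorm ℤ → ℓ ≠ q →
          ((Ideal.span {(ℓ : ℤ)}).primesOver (𝓞 K)).ncard = 2) ∧
        (¬ 2 ∣ W.conductorNorm ℤ → ((Ideal.span {(2 : ℤ)}).primesOver (𝓞 K)).ncard = 2) ∧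
        SatisfiesHeegnerHypothesis p K ∧
        ((Ideal.span {(2 : ℤ)}).primesOver (𝓞 K)).ncard = 2 ∧
        (∃ C : VariableChange ℚ, C • W.quadraticTwist (NumberField.discr K : ℚ) = Wd) ∧
        (W.quadraticTwist (NumberField.discr K : ℚ)).entireLFunction 1 ≠ 0 ∧
        Wd.analyticRank = 0 ∧ N10.CellGordTwo Wd p ∧ Surj Wd p := by
  have hw : W.rootNumber = -1 := (rootNumber_of_analyticRank_le_one W hpar).2 hr
  obtain ⟨K, iF, iN, hK, -, hqd, hsplit, h2, hpK, hL⟩ :=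
    TwistRootNumberOdd.exists_ramifiedAt_splitAt_twist_ne_zero_of_hoffsteinLuo_odd W hnf hHL
      (ThreeFieldRowClosedBFH.three_lt_ringChar_of_semistable_outside W p hp5 hss)
      (ThreeFieldRowClosedBFH.twistType_of_cellGordTwo_of_semistable_outside W p hp5 hcell hss) hw q hq2 hqm hqns p hp.out hqp.symm 0
  have h2K : ((Ideal.span {(2 : ℤ)}).primesOver (𝓞 K)).ncard = 2 := by
    by_cases h2N : 2 ∣ W.conductorNorm ℤ
    · exact hsplit 2 Nat.prime_two h2N (Ne.symm hq2)
    · exact h2 h2N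
  have hD0 : (NumberField.discr K : ℚ) ≠ 0 := by exact_mod_cast NumberField.discr_ne_zero K
  obtain ⟨Wd, iWd, iWdm, Cd', hCd'⟩ := exists_isGloballyMinimal_smul_eq_quadraticTwist W hD0
  have hWd : Cd'⁻¹ • W.quadraticTwist (NumberField.discr K : ℚ) = Wd := by rw [← hCd', inv_smul_smul]
  refine ⟨K, iF, iN, Wd, iWd, iWdm, hK, hqd, hsplit, h2, hpK, h2K, ⟨Cd'⁻¹, hWd⟩, hL, ?_, ?_, ?_⟩
  · exact analyticRank_eq_zero_tameTwist W K hmod Cd'⁻¹ hWd hL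
  · exact cellGordTwo_tameTwist W p K hp5 hK hpK h2K Cd'⁻¹ hWd hcell
  · exact surj_tameTwist W p K Cd'⁻¹ hWd hsurj

end FieldOne

/-- **THE TAME SUB-ROW IN ANALYTIC RANK ONE FROM TEN PRINTED THEOREMS** — the statement of
`TameRoadRowRankOneClosed.missingLowerBoundAt_rankOne_of_tameRoadRow_elevenFacts` re-keyed: the TEN hypotheses are skeleton v18's
`PrintedFactsTame` minus F5 — Kato/Wuthrich's cyclotomic half at a surjective prime, Delbourgo 1998 Prop. 4, GZK, a modular parametrisation,
Hoffstein–Luo 1997, Cai–Shu–Tian 2014 Thm 1.1 (ring class character), Hsieh 2014 Thm B, Liu–Zhang–Zhang 2018, Castella–Liu–Wan 2022 Thm. 8.2.1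
and §6.1. Derived in the tree: the entire continuation and parity (modularity), Gross–Zagier I.(7.3) over `ℚ`
(`ExplicitGrossZagierTrivialChar.GrossZagier1986_thm_I_7_3_of_thm11_ringClassChar`), Cai–Shu–Tian for the trivial character
(`…thm11_trivialChar_of_thm11_ringClassChar`), and F5 (LEAD g11). Proof = p728593's seven-step chain verbatim with the field supply of §1.
[cite: JetchevSkinnerWan2017, §7.4.1 (arXiv:1512.06894 p. 30)] [cite: CastellaLiuWan2022, Thm. 8.2.1 (1)] [cite: Kato2004Asterisque, Thm. 17.4]
[cite: Delbourgo1998, Prop. 4] [cite: HoffsteinLuo1997, Theorem (§1, pp. 435–436)] -/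
theorem missingLowerBoundAt_rankOne_of_tameRoadRow_tenFacts
    (hWu : Wuthrich2014.kato_halfEigenCharIdeal_dvd_cyclotomicPrime_of_surjective)
    (hDel : Delbourgo1998.prop4_rankZero_pow_dvd_constantCoeff)
    (hGZK : rank_eq_analyticRank_of_analyticRank_le_one) (hmodP : nonempty_modularParametrizationData)
    (hHL : HoffsteinLuo1997_exists_twist_L_one_ne_zero) (hCSTrc : CaiShuTian2014.thm11_ringClassChar)
    (hB : Hsieh2014.thmB_exists_isHsiehLFunction_coeff_norm_eq_one_unrPeriod_ramifiedSteinberg)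
    (hLZZ : LiuZhangZhang2018.thm151_thm153_modularCurve_heegnerVector_additive_ramifiedSteinberg)
    (h821 : CastellaLiuWan2022.thm821_XGr₂_charIdeal_mul_le_awayFromCyc_pStarTwist)
    (h61 : CastellaLiuWan2022.sec61_exists_isCastellaLiuWanLFunction₂_pStarTwist)
    (W : WeierstrassCurve ℚ) [W.IsElliptic] [W.IsGloballyMinimal] (p : ℕ) [Fact p.Prime]
    (hr : W.analyticRank = 1) (hcell : N10.CellGordTwo W p) (hrow : TameRoadRow W p) :
    MissingLowerBoundAt W p := by
  -- the derived facts
  have hnf : exists_isNewformOf := exists_isNewformOf_of_nonempty_modularParametrizationData hmodP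
  have hmod : hasEntireLFunction_rat := WeierstrassCurve.hasEntireLFunction_rat_of_exists_isNewformOf hnf
  have hpar : ∀ X : WeierstrassCurve ℚ, even_analyticRank_iff_rootNumber_eq_one X :=
    fun X ↦ even_analyticRank_iff_rootNumber_eq_one_of_exists_isNewformOf X hnf
  have hGZ73 : GrossZagier1986_thm_I_7_3 :=
    ExplicitGrossZagierTrivialChar.GrossZagier1986_thm_I_7_3_of_thm11_ringClassChar hmodP hHL hCSTrc
  have hCST : CaiShuTian2014.thm11_trivialChar :=
    ExplicitGrossZagierTrivialChar.thm11_trivialChar_of_thm11_ringClassChar hCSTrc hmod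
  have hrow' := hrow
  obtain ⟨hp5, hsurj, hss, q, hqF, hqp, hq2, hqm, hqns, hqv⟩ := hrow'
  -- the supply: the tame-road field `K` and the rank-zero twist `Wd` (from Hoffstein–Luo)
  obtain ⟨K, iF, iN, Wd, iWd, iWdm, hK, hqd, hsplit, h2, hpK, -, htw, -, hrd, hcelld, hsurjd⟩ :=
    exists_fieldOne_gordTwo_rankOne_of_hoffsteinLuo W p hnf hHL hpar hmod hp5 hr hcell hsurj hss hqp hq2 hqm hqns
  have hTRF : TameRoadField W p K := ⟨hK, ⟨q, hqF, ⟨hqp, hq2, hqm, hqns, hqv⟩, hqd, hsplit⟩, h2, hpK⟩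
  have hsum : W.analyticRank + Wd.analyticRank = 1 := by omega
  -- the tame road: ♭-inclusion ⟹ branch socket ⟹ Step L ⟹ joint lower half
  have hIncl := ThreeFieldRowClosed.flatInclusion_tameRoadRow hmodP hB h821 h61 W p K hcell hrow hTRF
  have hsock := TameBranchSocket.branchSocketAt_of_flatInclusionUnit_rankFree hB hLZZ hCST hGZK hmod W p K hp5 hcell.2.1 hsurj
    hTRF hIncl
  have hstepL := TameJointLower.tameStepLAt_of_branchSocketAt hCST hGZK hmod W p K Wd hp5 hcell.2.1 hTRF htw hsum hsock
  have hJ : JointLowerBoundAt W Wd p :=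
    TameJointLower.jointLowerBoundAt_of_tameRoadField_of_stepL hCST hGZK hmod hmodP hGZ73 W p K Wd hp5 hTRF htw hsum hstepL
  -- the twist's upper half from the tree (rank `0`, `ρ̄` onto, `p ≥ 5`)
  have hX4 : ClassX4Gord Wd p :=
    ⟨⟨hcelld.1, hcelld.2.1, hasIrreducibleModPGaloisRep_of_hasSurjectiveModNGaloisRep Wd p hsurjd⟩, hcelld.2.2.1⟩
  have hed : semistabilityIndex Wd p = 2 := hcelld.2.2.2
  have hram3 : p = 3 → Ram Wd p := fun h3 ↦ absurd h3 (by omega)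
  exact missingLowerBoundAt_of_joint_of_upper hJ
    (ClassX4Gord.missingUpperBoundAt_rankZero_of_katoHalf hWu hDel hGZK hmod hmodP hX4 hed hrd hsurjd hram3)

end Summit.BirchSwinnertonDyer.BirchSwinnertonDyer.Theorems.TameRoadRowRankOneClosedHL

end
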